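import Literature.MathematicalPhysics.KineticTheory.ConfinedLocalMinorization
import HarnessLib

/-!
# Additive-noise SDEs with a confined drift: a local small set at a FORCED equilibrium (Hörmander-free)

Trunk T-KINETIC (Literature/MathematicalPhysics/KineticTheory). Proof file of the provefact unit for
`CuneoEckmannHairerReyBellet2018_thm213_pureQuartic`; MODEL-FREE. `ConfinedLocalMinorization.lean`
minorises the transition probabilities `P_t(z, ·) = law Φ_t(z, B)` of
`dz = Y(z) dt + v₁ dB¹ + v₂ dB²` near an EQUILIBRIUM `x₀` of the drift (`Y x₀ = 0`) at which the
linearisation `(DY(x₀), v₁)` satisfies Kalman's condition. For chains whose linearisation at the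
rest point is degenerate (the purely quartic chain: `U''(0) = V''(0) = 0`, the interior sites are
decoupled to first order) that theorem is void. This file proves the same local minorisation near
a **forced equilibrium**: a point `x₀` with

  `Y x₀ + a • v₁ = 0`   (the drift is balanced by a CONSTANT control `a` in the noise direction `v₁`)

at which `(DY(x₀), v₁)` satisfies Kalman's condition. The reduction to the unforced theorem is the
pathwise identity behind the Cameron–Martin shift by a linear path, which for additive noise needs
no measure theory: adding the ramp `t ↦ (a t) v₁` to the noise path is the same as adding `a v₁` to
the drift,

  `Φ^Y_t(z, n + a t v₁) = Φ^{Y + a v₁}_t(z, n)`   (`drivenFlow_add_ramp`),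

and the ramp on `[0, 1]` IS a skeleton path at every dyadic level (`rampSkel`,
`skelNoisePath_add_rampSkel`: `PL^m` of the constant increment vector `a/2ᵐ` is `a · min(t, 1)`).
Hence the skeleton solution family of `Y` is the TRANSLATE, in the skeleton variable, of that of
the shifted drift `Y + a v₁` (`skelSol_eq_shift`), whose differential at `(x₀, 0, 0)` is onto by
`ConfinedLinearControl.lean` (`x₀` is a genuine equilibrium of the shifted drift, a confined drift
again: `ConfinedDrift.addNoiseConst`); so the skeleton differential of `Y` is onto at the base
skeleton `rampSkel m a` instead of `0`, and the finite-dimensional submersion argument of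
`ConfinedLocalMinorization.lean` runs verbatim around that base point (the Gaussian law of the
skeleton dominates Lebesgue measure on EVERY ball, `exists_wienerPair_map_pairSkel_ge`):

* `ConfinedDrift.addNoiseConst` — `Y + w`, `w` in the noise subspace, is a confined drift with the
  same energy if `DV(y)·w ≤ K₁ (V(y) + c)`;
* `drivenFlow_add_ramp`, `rampSkel`, `plInterp_const`, `skelNoisePath_add_rampSkel`;
* `ConfinedDrift.minorization_at_one_of_forced` — **local minorisation at time one near a forced
  equilibrium**: `P_1(z, T) ≥ c · Λ(T)` for measurable `T ⊆ B(x₀, r)`, `z ∈ B(x₀, ε₁)`;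
* `ConfinedDrift.exists_smul_restrict_le_sdeKernel_one_of_forced`,
  `ConfinedDrift.exists_localSmall_window_of_forced` — measure form and time-window form (the
  hypothesis shape `h_loc` of `Literature/Probability/Process/SmallSets.lean`).

## References

* N. Cuneo, J.-P. Eckmann, M. Hairer, L. Rey-Bellet, EJP **23** (2018) no. 55, Prop. 3.6 (proof),
  Cor. 3.4 (controls `u_b`, footnote: constant terms can be absorbed into the controls).
* J. C. Mattingly, É. Pardoux, CPAM **59** (2006), §§3–4; R. H. Cameron, W. T. Martin, Ann. Math.
  **45** (1944) 386–396 (translation of Wiener measure). [folklore]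
-/

noncomputable section

open MeasureTheory ProbabilityTheory Filter Topology Set Metric Function unitInterval
open scoped NNReal ENNReal
open Literature.Probability.Process Literature.Analysis.ODE Literature.Analysis.Calculus

namespace Literature.MathematicalPhysics.KineticTheory

variable {E : Type*} [NormedAddCommGroup E] [NormedSpace ℝ E]

/-! ### Small lemmas on the skeleton objects -/

/-- The piecewise-linear path starts at `0`. [folklore] -/
private theorem plInterp_time_zero'' (m : ℕ) (y : Fin (2 ^ m) → ℝ) : plInterp m y 0 = 0 := by
  simp [plInterp, tentCoeff]

/-- The remainders of the Brownian pair vanish at time `0`. [folklore] -/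
private theorem pairRem_apply_zero'' (m : ℕ) (w : WienerPair) :
    (pairRem m w).1 0 = 0 ∧ (pairRem m w).2 0 = 0 := by
  constructor <;> simp [pairRem, bridgeRem, plInterp_time_zero'', pairPath]

/-- **The piecewise-linear path with CONSTANT increments is the ramp**:
`PL^m_{(c, …, c)}(u) = c 2ᵐ min(1, u)` (telescoping sum of the tent coefficients). [folklore] -/
theorem plInterp_const (m : ℕ) (c : ℝ) (u : ℝ≥0) :
    plInterp m (fun _ : Fin (2 ^ m) => c) u = c * 2 ^ m * min 1 (u : ℝ) := by
  unfold plInterp tentCoeff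
  rw [← Finset.mul_sum, ← Finset.mul_sum]
  have htel : ∑ i : Fin (2 ^ m), (((min (KolmogorovChentsov.dyad m (i.val + 1)) u : ℝ≥0) : ℝ) -
      ((min (KolmogorovChentsov.dyad m i.val) u : ℝ≥0) : ℝ)) =
      ((min (KolmogorovChentsov.dyad m (2 ^ m)) u : ℝ≥0) : ℝ) -
        ((min (KolmogorovChentsov.dyad m 0) u : ℝ≥0) : ℝ) := by
    rw [Fin.sum_univ_eq_sum_range (fun i => (((min (KolmogorovChentsov.dyad m (i + 1)) u : ℝ≥0) : ℝ) -
      ((min (KolmogorovChentsov.dyad m i) u : ℝ≥0) : ℝ))) (2 ^ m)]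
    exact Finset.sum_range_sub (fun i => ((min (KolmogorovChentsov.dyad m i) u : ℝ≥0) : ℝ)) (2 ^ m)
  rw [htel]
  have h1 : KolmogorovChentsov.dyad m (2 ^ m) = 1 := by
    rw [KolmogorovChentsov.dyad]; push_cast; exact div_self (pow_ne_zero _ two_ne_zero)
  have h0 : KolmogorovChentsov.dyad m 0 = 0 := by simp [KolmogorovChentsov.dyad]
  rw [h1, h0]
  simp only [zero_le, min_eq_left, NNReal.coe_zero, sub_zero, NNReal.coe_min, NNReal.coe_one]
  ring

/-- The **ramp skeleton** of level `m` and slope `a`: constant increments `a / 2ᵐ` in the first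
noise component, none in the second (`PL^m` of it is the ramp `a · min(t, 1)`). [folklore] -/
def rampSkel (m : ℕ) (a : ℝ) : PairSkeleton m := (fun _ => a / 2 ^ m, 0)

/-- The norm of the ramp skeleton is at most `|a|`. [folklore] -/
theorem norm_rampSkel_le (m : ℕ) (a : ℝ) : ‖rampSkel m a‖ ≤ |a| := by
  rw [rampSkel, Prod.norm_def, norm_zero, max_le_iff]
  refine ⟨?_, abs_nonneg a⟩
  refine (pi_norm_le_iff_of_nonneg (abs_nonneg a)).2 fun _ => ?_
  rw [Real.norm_eq_abs, abs_div, abs_of_pos (by positivity : (0:ℝ) < 2 ^ m)]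
  exact div_le_self (abs_nonneg a) (one_le_pow₀ (by norm_num))

/-- **Adding the ramp skeleton adds the ramp**: `n_{x + rampSkel a, ρ}(t) = n_{x, ρ}(t) + (a min(1, t⁺)) v₁`.
[folklore] -/
theorem skelNoisePath_add_rampSkel {F : Submodule ℝ E} (m : ℕ) (v₁ v₂ : E) (a : ℝ)
    (x : PairSkeleton m) (ρ : C(I, F)) (t : ℝ) :
    skelNoisePath m v₁ v₂ (x + rampSkel m a) ρ t =
      skelNoisePath m v₁ v₂ x ρ t + (a * min 1 (max t 0)) • v₁ := by
  simp only [skelNoisePath_apply, rampSkel, Prod.fst_add, Prod.snd_add, add_zero, plInterp_add]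
  have hc : plInterp m (fun _ : Fin (2 ^ m) => a / 2 ^ m) t.toNNReal = a * min 1 (max t 0) := by
    rw [plInterp_const, Real.coe_toNNReal']
    field_simp
  rw [hc, add_smul]
  abel

/-! ### Adding a constant from the noise subspace to a confined drift -/

namespace ConfinedDrift

section AddConst

variable {Y : E → E} (D : ConfinedDrift Y)

/-- **A confined drift plus a constant noise-direction vector is a confined drift** with the same
energy, provided the energy grows at most linearly in that direction (`DV(y)·w ≤ K₁ (V(y) + c)`;
for a Langevin chain and a momentum direction this is `p_b ≤ 1 + H`). [folklore] -/
def addNoiseConst (w : E) {K₁ : ℝ} (hK₁ : 0 ≤ K₁)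
    (hw : ∀ y, fderiv ℝ D.V y w ≤ K₁ * (D.V y + D.c)) : ConfinedDrift (fun z => Y z + w) where
  V := D.V
  c := D.c
  K M := D.K M + K₁
  ρ := D.ρ
  noise := D.noise
  contDiff_drift := D.contDiff_drift.add contDiff_const
  differentiable_energy := D.differentiable_energy
  energy_nonneg := D.energy_nonneg
  rate_nonneg M hM := add_nonneg (D.rate_nonneg M hM) hK₁
  fderiv_energy_le M y e he heM := by
    rw [map_add]
    have h1 := D.fderiv_energy_le M y e he heM
    have h2 := hw y
    nlinarith
  norm_le_radius := D.norm_le_radius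
  radius_mono := D.radius_mono

/-- The noise subspace is unchanged. [folklore] -/
@[simp] theorem addNoiseConst_noise (w : E) {K₁ : ℝ} (hK₁ : 0 ≤ K₁)
    (hw : ∀ y, fderiv ℝ D.V y w ≤ K₁ * (D.V y + D.c)) : (D.addNoiseConst w hK₁ hw).noise = D.noise := rfl

end AddConst

/-! ### The pathwise Cameron–Martin identity for a ramp -/

section Ramp

variable [FiniteDimensional ℝ E] [CompleteSpace E] {Y : E → E} (D : ConfinedDrift Y)

/-- **Adding a ramp to the noise is adding a constant to the drift**: if `ℓ(t) = t • w` on `[0, T]`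
(`ℓ` continuous with values in the noise subspace, `w ∈ noise` with `DV(y)·w ≤ K₁(V(y) + c)`), then
on `[0, T]` `Φ^Y(x, n + ℓ) = Φ^{Y + w}(x, n)` — both solve `z(t) = x + n(t) + ∫₀ᵗ (Y(z) + w) ds`,
whose continuous solution is unique (`Y + w` is a confined drift, `addNoiseConst`). [folklore] -/
theorem drivenFlow_add_ramp {w : E} {K₁ : ℝ} (hK₁ : 0 ≤ K₁)
    (hw : ∀ y, fderiv ℝ D.V y w ≤ K₁ * (D.V y + D.c))
    (x : E) {n ℓ : ℝ → E} (hn : Continuous n) (hℓ : Continuous ℓ) (hnS : ∀ t, n t ∈ D.noise)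
    (hℓS : ∀ t, ℓ t ∈ D.noise) {T : ℝ} (hramp : ∀ t ∈ Icc 0 T, ℓ t = t • w) :
    EqOn (drivenFlow Y x (fun t => n t + ℓ t)) (drivenFlow (fun z => Y z + w) x n) (Icc 0 T) := by
  let D' : ConfinedDrift (fun z => Y z + w) := D.addNoiseConst w hK₁ hw
  have hnℓ : Continuous fun t => n t + ℓ t := hn.add hℓ
  have hnℓS : ∀ t, n t + ℓ t ∈ D.noise := fun t => D.noise.add_mem (hnS t) (hℓS t)
  have hzc : Continuous (drivenFlow Y x (fun t => n t + ℓ t)) := D.continuous_flow x hnℓ hnℓS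
  have hsol := D.isIntegralSolutionOn_flow x hnℓ hnℓS T
  have hnS' : ∀ t, n t ∈ D'.noise := fun t => hnS t
  refine D'.eqOn_flow x hn hnS' (fun t ht => ?_) hzc
  have hYc : Continuous fun s => Y (drivenFlow Y x (fun t => n t + ℓ t) s) :=
    D.contDiff_drift.continuous.comp hzc
  have h' : drivenFlow Y x (fun t => n t + ℓ t) t =
      x + (n t + ℓ t) + ∫ s in (0 : ℝ)..t, Y (drivenFlow Y x (fun t => n t + ℓ t) s) := hsol t ht
  show drivenFlow Y x (fun t => n t + ℓ t) t =
    x + n t + ∫ s in (0 : ℝ)..t, (Y (drivenFlow Y x (fun t => n t + ℓ t) s) + w)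
  rw [intervalIntegral.integral_add (hYc.intervalIntegrable _ _) intervalIntegrable_const,
    intervalIntegral.integral_const, h', hramp t ht, sub_zero]
  abel

end Ramp

/-! ### The skeleton solution families of `Y` and of the shifted drift -/

section Skel

variable [FiniteDimensional ℝ E] [CompleteSpace E] {Y : E → E} (D : ConfinedDrift Y)
  (m : ℕ) {v₁ v₂ : E} (hv₁ : v₁ ∈ D.noise) (hv₂ : v₂ ∈ D.noise) {a : ℝ}
  {K₁ : ℝ} (hK₁ : 0 ≤ K₁) (hgrow : ∀ y, fderiv ℝ D.V y (a • v₁) ≤ K₁ * (D.V y + D.c))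
include D hv₁ hv₂ hK₁ hgrow

/-- **The skeleton solution family of `Y` is the translate of that of `Y + a v₁`**: with
`S(z, x, ρ)(τ) = Φ^Y_τ(z, n_{x,ρ})` and `S'(z, x, ρ)(τ) = Φ^{Y + a v₁}_τ(z, n_{x,ρ})`,
`S(z, x + rampSkel a, ρ) = S'(z, x, ρ)`. [folklore] -/
theorem skelSol_eq_shift {S : E × PairSkeleton m × C(I, D.noise) → C(I, E)}
    (hS : ∀ p τ, S p τ = drivenFlow Y p.1 (skelNoisePath m v₁ v₂ p.2.1 p.2.2) τ)
    {S' : E × PairSkeleton m × C(I, D.noise) → C(I, E)}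
    (hS' : ∀ p τ, S' p τ = drivenFlow (fun z => Y z + a • v₁) p.1 (skelNoisePath m v₁ v₂ p.2.1 p.2.2) τ)
    (z : E) (x : PairSkeleton m) (ρ : C(I, D.noise)) (τ : I) :
    S (z, x + rampSkel m a, ρ) τ = S' (z, x, ρ) τ := by
  rw [hS, hS']
  simp only
  have hdecomp : skelNoisePath m v₁ v₂ (x + rampSkel m a) ρ =
      fun t => skelNoisePath m v₁ v₂ x ρ t + (a * min 1 (max t 0)) • v₁ :=
    funext fun t => skelNoisePath_add_rampSkel m v₁ v₂ a x ρ t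
  rw [hdecomp]
  refine D.drivenFlow_add_ramp hK₁ hgrow z (continuous_skelNoisePath m v₁ v₂ x ρ) ?_
    (skelNoisePath_mem m v₁ v₂ hv₁ hv₂ x ρ) (fun t => D.noise.smul_mem _ hv₁) (T := 1)
    (fun t ht => ?_) τ.2
  · exact ((continuous_const.mul (continuous_const.min (continuous_id.max continuous_const))).smul
      continuous_const)
  · rw [max_eq_left ht.1, min_eq_right ht.2, smul_smul, mul_comm]

end Skel

/-! ### The local minorisation near a forced equilibrium -/

section Forced

variable [FiniteDimensional ℝ E] [CompleteSpace E] [MeasurableSpace E] [BorelSpace E]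
  [SecondCountableTopology E] {Y : E → E} (D : ConfinedDrift Y) (hY : ContDiff ℝ 1 Y)
  {x₀ : E} {a : ℝ} {v₁ v₂ : E} (hv₁ : v₁ ∈ D.noise) (hv₂ : v₂ ∈ D.noise)
  (hx₀ : Y x₀ + a • v₁ = 0)
  {K₁ : ℝ} (hK₁ : 0 ≤ K₁) (hgrow : ∀ y, fderiv ℝ D.V y (a • v₁) ≤ K₁ * (D.V y + D.c))
  (hKal : ∀ ℓ : E →ₗ[ℝ] ℝ, (∀ k : ℕ, ℓ (((fderiv ℝ Y x₀) ^ k) v₁) = 0) → ℓ = 0)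
  (Λ : Measure E) [Λ.IsAddHaarMeasure]
include D hY hx₀ hv₁ hv₂ hK₁ hgrow hKal

/-- **Local minorisation at time one, near a FORCED equilibrium** (Hörmander-free): if
`Y x₀ + a • v₁ = 0` (the drift at `x₀` is balanced by the constant control `a` along the noise
direction `v₁`), the energy grows at most linearly along `a v₁`, and `(DY(x₀), v₁)` satisfies
Kalman's condition, then there are `ε₁, r > 0` and `c > 0` such that `P_1(z, T) ≥ c · Λ(T)` for
every measurable `T ⊆ B(x₀, r)` and every initial condition `z ∈ B(x₀, ε₁)`. Proof: the skeleton
solution family of `Y` is the translate by `rampSkel m a` of that of the confined drift `Y + a v₁`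
(`skelSol_eq_shift`), at whose equilibrium `x₀` the skeleton differential is onto for a fine level
`m` (`exists_skeleton_level_surjective`); the submersion estimate
(`exists_measure_preimage_ge_of_surjective`) at the base skeleton `rampSkel m a`, the Gaussian
lower bound for the skeleton law on the ball `B̄(rampSkel m a, ρ₀) ⊆ B̄(0, |a| + ρ₀)` and the
positive probability of small bridges conclude as in `minorization_at_one`.
[cite: CuneoEckmannHairerReyBellet2018, Prop 3.6 (proof)] -/
theorem minorization_at_one_of_forced :
    ∃ ε₁ : ℝ, 0 < ε₁ ∧ ∃ r : ℝ, 0 < r ∧ ∃ c : ℝ≥0∞, 0 < c ∧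
      ∀ z ∈ ball x₀ ε₁, ∀ T ⊆ ball x₀ r, MeasurableSet T →
        c * Λ T ≤ sdeKernel Y v₁ v₂ 1 z T := by
  classical
  -- the shifted drift and its confinement
  set Y' : E → E := fun z => Y z + a • v₁ with hY'def
  let D' : ConfinedDrift Y' := D.addNoiseConst (a • v₁) hK₁ hgrow
  have hY' : ContDiff ℝ 1 Y' := hY.add contDiff_const
  have hx₀' : Y' x₀ = 0 := hx₀
  have hv₁' : v₁ ∈ D'.noise := hv₁
  have hv₂' : v₂ ∈ D'.noise := hv₂
  have hfd : fderiv ℝ Y' x₀ = fderiv ℝ Y x₀ := by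
    rw [hY'def]; exact fderiv_add_const _
  have hKal' : ∀ ℓ : E →ₗ[ℝ] ℝ, (∀ k : ℕ, ℓ (((fderiv ℝ Y' x₀) ^ k) v₁) = 0) → ℓ = 0 := by
    intro ℓ hℓ; rw [hfd] at hℓ; exact hKal ℓ hℓ
  -- the level `m` and the skeleton objects (for `Y'` and for `Y`), all typed over `D.noise`
  obtain ⟨m, hm⟩ := D'.exists_skeleton_level_surjective hY' hx₀' hv₁' hv₂' hKal'
  obtain ⟨g, hg⟩ := exists_skelForcingCLM (F := D.noise) m v₁ v₂
  obtain ⟨S', hSapply', hS', huniq', hdiff'⟩ : ∃ S' : E × PairSkeleton m × C(I, D.noise) → C(I, E),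
      (∀ p τ, S' p τ = drivenFlow Y' p.1 (skelNoisePath m v₁ v₂ p.2.1 p.2.2) τ) ∧
      (∀ p, forcedRobbinMap Y' g (p, S' p) = 0) ∧
      (∀ p α, forcedRobbinMap Y' g (p, α) = 0 → α = S' p) ∧ ContDiff ℝ 1 S' :=
    D'.exists_skelSol m hv₁' hv₂' g hg le_rfl hY'
  obtain ⟨S, hSapply, -, -, hdiff⟩ := D.exists_skelSol m hv₁ hv₂ g hg le_rfl hY
  have hS0' : S' (x₀, (0 : PairSkeleton m), (0 : C(I, D.noise))) = ContinuousMap.const I x₀ :=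
    D'.skelSol_equilibrium m hSapply' hx₀'
  -- the inclusion of the skeleton variable
  let ι : PairSkeleton m →L[ℝ] E × PairSkeleton m × C(I, D.noise) :=
    (ContinuousLinearMap.inr ℝ E (PairSkeleton m × C(I, D.noise))).comp
      (ContinuousLinearMap.inl ℝ (PairSkeleton m) C(I, D.noise))
  have hι : ∀ x : PairSkeleton m, ι x = ((0 : E), x, (0 : C(I, D.noise))) := fun x => rfl
  have hsurjT' : LinearMap.range (((ContinuousMap.evalCLM ℝ (1 : I)).comp
      ((fderiv ℝ S' (x₀, 0, 0)).comp ι)) : PairSkeleton m →ₗ[ℝ] E) = ⊤ := hm g hg S' hS' huniq'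
  set xs : PairSkeleton m := rampSkel m a with hxs
  -- the translation relation `S (z, x, ρ) = S' (z, x - xs, ρ)`
  have hshift : ∀ (z : E) (x : PairSkeleton m) (ρ : C(I, D.noise)),
      S (z, x, ρ) = S' (z, x - xs, ρ) := by
    intro z x ρ
    refine ContinuousMap.ext fun τ => ?_
    have h := D.skelSol_eq_shift m hv₁ hv₂ hK₁ hgrow hSapply hSapply' z (x - xs) ρ τ
    rw [sub_add_cancel] at h
    exact h
  -- the map `f (z, ρ) x = S (z, x, ρ) 1 = S' (z, x - xs, ρ) 1` and its partial differential in `x`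
  let f : E × C(I, D.noise) → PairSkeleton m → E := fun p x => S (p.1, x, p.2) 1
  let f₀ : E × C(I, D.noise) → PairSkeleton m → E := fun p x => S' (p.1, x, p.2) 1
  let f₀' : E × C(I, D.noise) → PairSkeleton m → PairSkeleton m →L[ℝ] E :=
    fun p x => (ContinuousMap.evalCLM ℝ (1 : I)).comp ((fderiv ℝ S' (p.1, x, p.2)).comp ι)
  let f' : E × C(I, D.noise) → PairSkeleton m → PairSkeleton m →L[ℝ] E := fun p x => f₀' p (x - xs)
  have hff₀ : ∀ p, f p = fun x => f₀ p (x - xs) := by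
    intro p
    funext x
    show S (p.1, x, p.2) 1 = S' (p.1, x - xs, p.2) 1
    rw [hshift]
  have hSd' : Differentiable ℝ S' := hdiff'.differentiable one_ne_zero
  have hf₀' : ∀ p x, HasFDerivAt (f₀ p) (f₀' p x) x := by
    intro p x
    have hA : HasFDerivAt (fun x : PairSkeleton m => (p.1, x, p.2)) ι x := by
      have h1 : (fun x : PairSkeleton m => (p.1, x, p.2)) = fun x => ι x + (p.1, 0, p.2) := by
        funext x; rw [hι]; simp
      rw [h1]
      exact ι.hasFDerivAt.add_const _
    have hSx := (hSd' (p.1, x, p.2)).hasFDerivAt.comp x hA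
    exact (ContinuousMap.evalCLM ℝ (1 : I)).hasFDerivAt.comp x hSx
  have hf' : ∀ p x, HasFDerivAt (f p) (f' p x) x := by
    intro p x
    rw [hff₀ p]
    have h := (hf₀' p (x - xs)).comp x ((hasFDerivAt_id x).sub_const xs)
    rwa [ContinuousLinearMap.comp_id] at h
  have hcontf' : Continuous fun q : (E × C(I, D.noise)) × PairSkeleton m => f' q.1 q.2 := by
    have h1 : Continuous fun q : (E × C(I, D.noise)) × PairSkeleton m =>
        fderiv ℝ S' (q.1.1, q.2 - xs, q.1.2) :=
      (hdiff'.continuous_fderiv one_ne_zero).comp (by fun_prop)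
    exact continuous_const.clm_comp (h1.clm_comp continuous_const)
  have hcontf : Continuous fun p : E × C(I, D.noise) => f p xs :=
    (ContinuousMap.evalCLM ℝ (1 : I)).continuous.comp (hdiff.continuous.comp (by fun_prop))
  have hf00 : f (x₀, 0) xs = x₀ := by
    show S (x₀, xs, (0 : C(I, D.noise))) 1 = x₀
    rw [hshift, sub_self, hS0']
    rfl
  have hsurj : LinearMap.range (f' (x₀, 0) xs : PairSkeleton m →ₗ[ℝ] E) = ⊤ := by
    show LinearMap.range ((f₀' (x₀, 0) (xs - xs)) : PairSkeleton m →ₗ[ℝ] E) = ⊤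
    rw [sub_self]
    exact hsurjT'
  -- nontriviality of the skeleton space
  haveI : Nontrivial (PairSkeleton m) := by
    refine ⟨⟨0, (fun _ => 1, 0), fun h => ?_⟩⟩
    have := congrArg (fun q : PairSkeleton m => q.1 ⟨0, Nat.two_pow_pos m⟩) h
    simp at this
  -- Haar instances on the skeleton space
  haveI hpiS : (volume : Measure (Fin (2 ^ m) → ℝ)).IsAddHaarMeasure := isAddHaarMeasure_volume_pi _
  haveI hvolS : (volume : Measure (PairSkeleton m)).IsAddHaarMeasure :=
    Measure.prod.instIsAddHaarMeasure (volume : Measure (Fin (2 ^ m) → ℝ))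
      (volume : Measure (Fin (2 ^ m) → ℝ))
  -- the submersion estimate, uniformly in `(z, ρ)` near `(x₀, 0)`, at the base skeleton `xs`
  obtain ⟨V, hV, ρ₀, hρ₀, r, hr, c, hc, hmin⟩ :=
    exists_measure_preimage_ge_of_surjective (volume : Measure (PairSkeleton m)) Λ f f'
      (Eventually.of_forall fun q => hf' q.1 q.2) hcontf'.continuousAt hcontf.continuousAt hsurj
  rw [hf00] at hmin
  obtain ⟨ε₁, hε₁, hε₁V⟩ := Metric.mem_nhds_iff.1 hV
  -- the law of the skeleton dominates Lebesgue measure on the ball of radius `|a| + ρ₀` about `0`,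
  -- which contains the ball of radius `ρ₀` about `xs`
  obtain ⟨c₂, hc₂, hskel⟩ := exists_wienerPair_map_pairSkel_ge m (|a| + ρ₀)
  have hballsub : closedBall xs ρ₀ ⊆ closedBall (0 : PairSkeleton m) (|a| + ρ₀) := by
    intro y hy
    rw [mem_closedBall, dist_zero_right]
    rw [mem_closedBall] at hy
    calc ‖y‖ = ‖(y - xs) + xs‖ := by rw [sub_add_cancel]
      _ ≤ ‖y - xs‖ + ‖xs‖ := norm_add_le _ _
      _ ≤ ρ₀ + |a| := add_le_add (by rwa [← dist_eq_norm]) (norm_rampSkel_le m a)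
      _ = |a| + ρ₀ := add_comm _ _
  -- the good remainders
  have hCpos : 0 < (‖v₁‖ + ‖v₂‖ + 1) * (1 + 2 * 2 ^ m) := by positivity
  set ε' : ℝ := ε₁ / 2 / ((‖v₁‖ + ‖v₂‖ + 1) * (1 + 2 * 2 ^ m)) with hε'
  have hε'pos : 0 < ε' := by positivity
  have hε'bound : (‖v₁‖ + ‖v₂‖) * ((1 + 2 * 2 ^ m) * ε') < ε₁ := by
    have h1 : (‖v₁‖ + ‖v₂‖) * ((1 + 2 * 2 ^ m) * ε') ≤ (‖v₁‖ + ‖v₂‖ + 1) * ((1 + 2 * 2 ^ m) * ε') :=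
      mul_le_mul_of_nonneg_right (by linarith) (by positivity)
    have h2 : (‖v₁‖ + ‖v₂‖ + 1) * ((1 + 2 * 2 ^ m) * ε') = ε₁ / 2 := by
      rw [hε']; field_simp
    linarith
  -- the set of good remainder pairs (countably many conditions: measurable)
  set GoodR : Set WienerPair := {rr | (∀ n k : ℕ, ((k : ℝ≥0) / 2 ^ n ≤ 1) →
      |rr.1 ((k : ℝ≥0) / 2 ^ n)| ≤ (1 + 2 * 2 ^ m) * ε' ∧ |rr.2 ((k : ℝ≥0) / 2 ^ n)| ≤ (1 + 2 * 2 ^ m) * ε')}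
    with hGoodR
  have hGoodRm : MeasurableSet GoodR := by
    have : GoodR = ⋂ n : ℕ, ⋂ k : ℕ, {rr : WienerPair | ((k : ℝ≥0) / 2 ^ n ≤ 1) →
        |rr.1 ((k : ℝ≥0) / 2 ^ n)| ≤ (1 + 2 * 2 ^ m) * ε' ∧
          |rr.2 ((k : ℝ≥0) / 2 ^ n)| ≤ (1 + 2 * 2 ^ m) * ε'} := by
      ext rr; simp [hGoodR]
    rw [this]
    refine MeasurableSet.iInter fun n => MeasurableSet.iInter fun k => ?_
    by_cases hkn : (k : ℝ≥0) / 2 ^ n ≤ 1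
    · simp only [hkn, forall_const]
      exact (measurableSet_le ((measurable_pi_apply _).comp measurable_fst).abs measurable_const).inter
        (measurableSet_le ((measurable_pi_apply _).comp measurable_snd).abs measurable_const)
    · simp [hkn]
  -- the good event of the Brownian pair forces a good remainder
  have hgood_sub : goodEvent ε' 1 ⊆ (pairRem m) ⁻¹' GoodR := by
    intro w hw n k hk
    exact abs_pairRem_le_of_mem_goodEvent m hw hk
  have hgood_pos : 0 < wienerPair (goodEvent ε' 1) := wienerPair_goodEvent_pos hε'pos 1
  -- the constant
  refine ⟨ε₁, hε₁, r, hr, c₂ * c * wienerPair (goodEvent ε' 1),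
    ENNReal.mul_pos (ENNReal.mul_pos hc₂.ne' hc.ne').ne' hgood_pos.ne', fun z hz T hT hTm => ?_⟩
  -- the transition probability as a Wiener integral, factorised through the skeleton
  have hkernel : sdeKernel Y v₁ v₂ 1 z T =
      wienerPair ((fun w => sdeSolMap Y v₁ v₂ 1 z (pairPath w)) ⁻¹' T) := by
    have h := D.sdeKernel_apply' hv₁ hv₂ 1 z hTm
    simpa using h
  -- the integrand `G(x, rr) = 1_T(Φ_1(z, PL x + rr)) 1_{GoodR}(rr)`
  have h1m := D.measurable_sdeSolMap hv₁ hv₂ (1 : ℝ)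
  have h2m : Measurable fun q : PairSkeleton m × WienerPair => ((z : E), pairRecon m q.1 q.2) :=
    measurable_const.prodMk (measurable_pairRecon m)
  have hsolm : Measurable ((fun p : E × WienerPair => sdeSolMap Y v₁ v₂ 1 p.1 p.2) ∘
      (fun q : PairSkeleton m × WienerPair => ((z : E), pairRecon m q.1 q.2))) :=
    Measurable.comp h1m h2m
  let G : PairSkeleton m × WienerPair → ℝ≥0∞ := fun q =>
    ((T.indicator (1 : E → ℝ≥0∞)) ∘ ((fun p : E × WienerPair => sdeSolMap Y v₁ v₂ 1 p.1 p.2) ∘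
      (fun q : PairSkeleton m × WienerPair => ((z : E), pairRecon m q.1 q.2)))) q *
      GoodR.indicator 1 q.2
  have hGm : Measurable G :=
    ((measurable_one.indicator hTm).comp hsolm).mul ((measurable_one.indicator hGoodRm).comp measurable_snd)
  -- `G(Ξ ω, R ω) ≤ 1_{Φ_1(z, B ω) ∈ T}`
  have hGle : ∀ w, G (pairSkel m w, pairRem m w) ≤
      ((fun w => sdeSolMap Y v₁ v₂ 1 z (pairPath w)) ⁻¹' T).indicator 1 w := by
    intro w
    simp only [G, Function.comp_apply]
    rw [pairRecon_pairSkel_pairRem]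
    by_cases hmem : sdeSolMap Y v₁ v₂ 1 z (pairPath w) ∈ T
    · rw [indicator_of_mem hmem, indicator_of_mem
        (show w ∈ (fun w => sdeSolMap Y v₁ v₂ 1 z (pairPath w)) ⁻¹' T from hmem)]
      simp only [Pi.one_apply, one_mul]
      exact indicator_le_self' (fun _ _ => zero_le_one) _
    · rw [indicator_of_notMem hmem, zero_mul]
      exact zero_le
  -- for a good remainder of the Brownian pair, the inner integral is at least `c₂ c Λ(T)`
  have hinner : ∀ w, pairRem m w ∈ GoodR →
      c₂ * c * Λ T ≤ ∫⁻ x, G (x, pairRem m w) ∂(wienerPair.map (pairSkel m)) := by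
    intro w hwR
    set rr := pairRem m w with hrr
    have hr1 : Continuous rr.1 := continuous_pairRem_fst m w
    have hr2 : Continuous rr.2 := continuous_pairRem_snd m w
    obtain ⟨hr10, hr20⟩ := pairRem_apply_zero'' m w
    -- the remainder noise path and its smallness
    let ρr : C(I, D.noise) := remNoisePath m hv₁ hv₂ w
    have hρr : ∀ τ : I, (ρr τ : E) = rr.1 ⟨(τ : ℝ), τ.2.1⟩ • v₁ + rr.2 ⟨(τ : ℝ), τ.2.1⟩ • v₂ :=
      fun τ => remNoisePath_apply m hv₁ hv₂ w τ
    have hsmall : ∀ u : ℝ≥0, u ≤ 1 →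
        |rr.1 u| ≤ (1 + 2 * 2 ^ m) * ε' ∧ |rr.2 u| ≤ (1 + 2 * 2 ^ m) * ε' := by
      intro u hu
      exact ⟨abs_le_of_dyadic hr1 (fun n k hk => (hwR n k hk).1) hu,
        abs_le_of_dyadic hr2 (fun n k hk => (hwR n k hk).2) hu⟩
    have hρnorm : ‖ρr‖ < ε₁ := by
      refine (ContinuousMap.norm_lt_iff _ hε₁).2 fun τ => ?_
      rw [Submodule.coe_norm, hρr]
      obtain ⟨h1, h2⟩ := hsmall ⟨(τ : ℝ), τ.2.1⟩ (by exact_mod_cast τ.2.2)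
      have hL' : ‖rr.1 ⟨(τ : ℝ), τ.2.1⟩ • v₁‖ ≤ ‖v₁‖ * ((1 + 2 * 2 ^ m) * ε') := by
        rw [norm_smul, Real.norm_eq_abs, mul_comm]
        exact mul_le_mul_of_nonneg_left h1 (norm_nonneg _)
      have hR' : ‖rr.2 ⟨(τ : ℝ), τ.2.1⟩ • v₂‖ ≤ ‖v₂‖ * ((1 + 2 * 2 ^ m) * ε') := by
        rw [norm_smul, Real.norm_eq_abs, mul_comm]
        exact mul_le_mul_of_nonneg_left h2 (norm_nonneg _)
      calc _ ≤ ‖rr.1 ⟨(τ : ℝ), τ.2.1⟩ • v₁‖ + ‖rr.2 ⟨(τ : ℝ), τ.2.1⟩ • v₂‖ := norm_add_le _ _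
        _ ≤ ‖v₁‖ * ((1 + 2 * 2 ^ m) * ε') + ‖v₂‖ * ((1 + 2 * 2 ^ m) * ε') := add_le_add hL' hR'
        _ = (‖v₁‖ + ‖v₂‖) * ((1 + 2 * 2 ^ m) * ε') := by ring
        _ < ε₁ := hε'bound
    -- `(z, ρr) ∈ V`
    have hzρ : ((z, ρr) : E × C(I, D.noise)) ∈ V := by
      refine hε₁V ?_
      rw [mem_ball, Prod.dist_eq, max_lt_iff, dist_zero_right]
      exact ⟨mem_ball.1 hz, hρnorm⟩
    -- the inner integrand is the indicator of `{x | f (z, ρr) x ∈ T}`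
    have hGeq : ∀ x, G (x, rr) = ((f (z, ρr)) ⁻¹' T).indicator 1 x := by
      intro x
      simp only [G, Function.comp_apply]
      rw [indicator_of_mem hwR, Pi.one_apply, mul_one,
        D.sdeSolMap_one_pairRecon_eq_skelSol m hv₁ hv₂ hSapply x hr1 hr2 hr10 hr20 ρr hρr z]
      rfl
    simp_rw [hGeq]
    have hfTm : MeasurableSet ((f (z, ρr)) ⁻¹' T) :=
      ((hf' (z, ρr) ·) |> fun h => (continuous_iff_continuousAt.2 fun x => (h x).continuousAt)).measurable hTm
    rw [lintegral_indicator_one hfTm]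
    calc c₂ * c * Λ T = c₂ * (c * Λ T) := mul_assoc _ _ _
      _ ≤ c₂ * volume (closedBall xs ρ₀ ∩ f (z, ρr) ⁻¹' T) :=
          mul_le_mul' le_rfl (hmin (z, ρr) hzρ T hT hTm)
      _ ≤ wienerPair.map (pairSkel m) (closedBall xs ρ₀ ∩ f (z, ρr) ⁻¹' T) :=
          hskel _ (inter_subset_left.trans hballsub) (measurableSet_closedBall.inter hfTm)
      _ ≤ wienerPair.map (pairSkel m) (f (z, ρr) ⁻¹' T) := measure_mono inter_subset_right
  -- assemble: Wiener integral ≥ factorised integral ≥ good part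
  rw [hkernel, ← lintegral_indicator_one ((hTm.preimage
    (D.measurable_sdeSolMap_pairPath_right hv₁ hv₂ 1 z)))]
  calc c₂ * c * wienerPair (goodEvent ε' 1) * Λ T
      = c₂ * c * Λ T * wienerPair (goodEvent ε' 1) := by ring
    _ ≤ c₂ * c * Λ T * wienerPair ((pairRem m) ⁻¹' GoodR) := by
        gcongr
    _ = ∫⁻ w, ((pairRem m) ⁻¹' GoodR).indicator (fun _ => c₂ * c * Λ T) w ∂wienerPair := by
        rw [lintegral_indicator_const (hGoodRm.preimage (measurable_pairRem m))]
    _ ≤ ∫⁻ w, ∫⁻ x, G (x, pairRem m w) ∂(wienerPair.map (pairSkel m)) ∂wienerPair := by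
        refine lintegral_mono fun w => ?_
        by_cases hwR : pairRem m w ∈ GoodR
        · rw [indicator_of_mem (show w ∈ (pairRem m) ⁻¹' GoodR from hwR)]
          exact hinner w hwR
        · rw [indicator_of_notMem (show w ∉ (pairRem m) ⁻¹' GoodR from hwR)]
          exact zero_le
    _ = ∫⁻ w, G (pairSkel m w, pairRem m w) ∂wienerPair := (lintegral_pairSkel_pairRem m hGm).symm
    _ ≤ ∫⁻ w, ((fun w => sdeSolMap Y v₁ v₂ 1 z (pairPath w)) ⁻¹' T).indicator 1 w ∂wienerPair :=
        lintegral_mono hGle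

/-- **The minorisation at time one in measure form**: `P_1(z, ·) ≥ c Λ|_{B(x₀, r)}` for all
`z ∈ B(x₀, ε₁)`, near a forced equilibrium. [cite: CuneoEckmannHairerReyBellet2018, Prop 3.6 (proof)] -/
theorem exists_smul_restrict_le_sdeKernel_one_of_forced :
    ∃ ε₁ : ℝ, 0 < ε₁ ∧ ∃ r : ℝ, 0 < r ∧ ∃ c : ℝ≥0∞, 0 < c ∧
      ∀ z ∈ ball x₀ ε₁, c • Λ.restrict (ball x₀ r) ≤ sdeKernel Y v₁ v₂ 1 z := by
  obtain ⟨ε₁, hε₁, r, hr, c, hc, h⟩ := D.minorization_at_one_of_forced hY hv₁ hv₂ hx₀ hK₁ hgrow hKal Λ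
  refine ⟨ε₁, hε₁, r, hr, c, hc, fun z hz => Measure.le_iff.2 fun T hTm => ?_⟩
  rw [Measure.smul_apply, Measure.restrict_apply hTm, smul_eq_mul]
  exact (h z hz (T ∩ ball x₀ r) inter_subset_right (hTm.inter measurableSet_ball)).trans
    (measure_mono inter_subset_left)

/-- **A local small set at a forced equilibrium, in a time window** (Hörmander-free): if
`Y x₀ + a • v₁ = 0`, the energy grows at most linearly along `a v₁`, and `(DY(x₀), v₁)` satisfies
Kalman's condition, then there are an open neighbourhood `G₀` of `x₀`, a non-empty open set `U₀`,
`η > 0` and a time window `[t₀ - δ, t₀ + δ]` (`0 < δ ≤ t₀`) with `P_t(w, ·) ≥ η Λ|_{U₀}` for all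
`w ∈ G₀` and all `t` in the window. [cite: CuneoEckmannHairerReyBellet2018, Prop 3.6 (proof)] -/
theorem exists_localSmall_window_of_forced :
    ∃ (G₀ U₀ : Set E) (η : ℝ≥0∞) (t₀ δ : ℝ), IsOpen G₀ ∧ x₀ ∈ G₀ ∧ IsOpen U₀ ∧ U₀.Nonempty ∧
      0 < η ∧ 0 < δ ∧ δ ≤ t₀ ∧ ∀ t : ℝ≥0, t₀ - δ ≤ (t : ℝ) → (t : ℝ) ≤ t₀ + δ →
        ∀ w ∈ G₀, η • Λ.restrict U₀ ≤ sdeKernel Y v₁ v₂ t w := by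
  obtain ⟨ε₁, hε₁, r, hr, c, hc, hmin⟩ :=
    D.exists_smul_restrict_le_sdeKernel_one_of_forced hY hv₁ hv₂ hx₀ hK₁ hgrow hKal Λ
  obtain ⟨δ, hδ, hwin⟩ := D.exists_window_smul_restrict_le_sdeKernel hv₁ hv₂ x₀ hε₁ (t₁ := 1) hmin
  refine ⟨ball x₀ (ε₁ / 2), ball x₀ r, 2⁻¹ * c, 1 + δ / 2, δ / 2, isOpen_ball,
    mem_ball_self (half_pos hε₁), isOpen_ball, ⟨x₀, mem_ball_self hr⟩,
    ENNReal.mul_pos (by simp) hc.ne', half_pos hδ, by linarith, fun t ht1 ht2 w hw => ?_⟩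
  refine hwin t ?_ ?_ w hw
  · rw [NNReal.coe_one]; linarith
  · rw [NNReal.coe_one]; linarith

end Forced

end ConfinedDrift

end Literature.MathematicalPhysics.KineticTheory

end
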